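import Mathlib
import HarnessLib

/-!
# Realification `ℂ^N ≅ ℝ^{2N}` for the CP(N−1) site law: `Re⟨F, z⟩ = F_ℝ · z_ℝ` and `|z|² = z_ℝ · z_ℝ`

HONEST FRAMING: exact (Metropolis-corrected) sampling algorithms for lattice gauge theory;
figures of merit are autocorrelation/cost numbers at stated couplings and volumes; no
continuum-physics claim.

Venture `LatticeQCDFlow` (cell pub-lqcd), topic `Exactness`, FANOUT row 9 (eng-latcore, the
engine `latflow.core`, `cpn_2d`).  NEW WORK of the cell (coordinate bookkeeping over Mathlib);
nothing is cited as a fact.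

The engine's CP(N−1) site variable is a unit vector `z ∈ ℂ^N` with one-site weight
`e^{κ Re(F†z)}` (`F` = the sum of the neighbouring `λ̄ z` terms); row 9's sphere files
(`SphereStein.lean`, `SphereOrbitLaw.lean`, `RadialPolar.lean`) speak of REAL unit vectors
`x ∈ ℝ^d` with weight `e^{κ F·x}`.  This file is the dictionary between the two, left as
"realification `ℂ^N ≅ ℝ^{2N}` (coordinates only)" in those files: with `x = realify z`
(real parts, then imaginary parts, index type `n ⊕ n`), `Re(F†z) = realify F ⬝ᵥ realify z` and
`Σ |zᵢ|² = realify z ⬝ᵥ realify z`, and `realify` is a real-linear bijection; so the complex unit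
sphere with the CP(N−1) site weight IS the real unit sphere of `ℝ^{n ⊕ n}` with the weight of
`SphereStein.lean`, `d = 2N ≥ 2`.

## What is proved (`n` a finite index type)

* `realify z : n ⊕ n → ℝ` (`inl i ↦ Re zᵢ`, `inr i ↦ Im zᵢ`), real-linear (`realifyLin`), with
  inverse `complexify` (`complexify_realify`, `realify_complexify`).
* **`realify_dotProduct`** — `realify F ⬝ᵥ realify z = Re (Σᵢ conj(Fᵢ) zᵢ)`.
* **`realify_dotProduct_self`** — `realify z ⬝ᵥ realify z = Σᵢ ‖zᵢ‖²`; `card (n ⊕ n) = 2 card n`.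
* `exp_site_weight_eq` — `e^{κ Re Σ conj(Fᵢ) zᵢ} = e^{κ (realify F ⬝ᵥ realify z)}`.

NOT CLAIMED: anything measure-theoretic (the sphere measure statements live in the files above and
apply verbatim with `m := n ⊕ n`).
-/

namespace Summit.Ventures.LatticeQCDFlow.Exactness

open Matrix Complex

variable {n : Type*}

/-- Real coordinates of a complex vector: real parts on the left copy of the index type, imaginary
parts on the right copy. -/
def realify (z : n → ℂ) : n ⊕ n → ℝ := Sum.elim (fun i => (z i).re) (fun i => (z i).im)

/-- The complex vector with given real coordinates. -/
def complexify (x : n ⊕ n → ℝ) : n → ℂ := fun i => ⟨x (Sum.inl i), x (Sum.inr i)⟩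

/-- Left coordinates are real parts. -/
@[simp] theorem realify_inl (z : n → ℂ) (i : n) : realify z (Sum.inl i) = (z i).re := rfl

/-- Right coordinates are imaginary parts. -/
@[simp] theorem realify_inr (z : n → ℂ) (i : n) : realify z (Sum.inr i) = (z i).im := rfl

/-- `complexify ∘ realify = id`. -/
@[simp] theorem complexify_realify (z : n → ℂ) : complexify (realify z) = z := by
  funext i
  exact Complex.ext rfl rfl

/-- `realify ∘ complexify = id`. -/
@[simp] theorem realify_complexify (x : n ⊕ n → ℝ) : realify (complexify x) = x := by
  funext k
  rcases k with i | i <;> rfl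

/-- `realify` as a real-linear equivalence `(n → ℂ) ≃ₗ[ℝ] (n ⊕ n → ℝ)`. -/
def realifyLin : (n → ℂ) ≃ₗ[ℝ] (n ⊕ n → ℝ) where
  toFun := realify
  invFun := complexify
  map_add' z w := by
    funext k; rcases k with i | i <;> simp [realify]
  map_smul' c z := by
    funext k; rcases k with i | i <;> simp [realify]
  left_inv := complexify_realify
  right_inv := realify_complexify

variable [Fintype n]

/-- **The real part of the Hermitian pairing is the real dot product of the realifications**:
`realify F ⬝ᵥ realify z = Re Σᵢ conj(Fᵢ) zᵢ`. -/
theorem realify_dotProduct (F z : n → ℂ) :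
    realify F ⬝ᵥ realify z = (∑ i, (starRingEnd ℂ) (F i) * z i).re := by
  rw [dotProduct, Fintype.sum_sum_type, Complex.re_sum, ← Finset.sum_add_distrib]
  refine Finset.sum_congr rfl fun i _ => ?_
  simp [Complex.mul_re, Complex.conj_re, Complex.conj_im]

/-- **The squared length is preserved**: `realify z ⬝ᵥ realify z = Σᵢ ‖zᵢ‖²`. -/
theorem realify_dotProduct_self (z : n → ℂ) : realify z ⬝ᵥ realify z = ∑ i, ‖z i‖ ^ 2 := by
  rw [dotProduct, Fintype.sum_sum_type, ← Finset.sum_add_distrib]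
  refine Finset.sum_congr rfl fun i _ => ?_
  rw [realify_inl, realify_inr, Complex.sq_norm, Complex.normSq_apply]

/-- The real dimension doubles: `card (n ⊕ n) = 2 · card n` (so `d = 2N ≥ 2` as soon as `N ≥ 1`). -/
theorem card_sum_self : Fintype.card (n ⊕ n) = 2 * Fintype.card n := by
  rw [Fintype.card_sum]; ring

/-- A non-empty index type gives real dimension at least two (the hypothesis of the sphere files). -/
theorem two_le_card_sum_self [Nonempty n] : 2 ≤ Fintype.card (n ⊕ n) := by
  rw [card_sum_self]
  have := Fintype.card_pos (α := n)
  omega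

/-- **The CP(N−1) site weight in real coordinates**: `e^{κ Re Σ conj(Fᵢ) zᵢ} = e^{κ (F_ℝ · z_ℝ)}`. -/
theorem exp_site_weight_eq (κ : ℝ) (F z : n → ℂ) :
    Real.exp (κ * (∑ i, (starRingEnd ℂ) (F i) * z i).re) = Real.exp (κ * (realify F ⬝ᵥ realify z)) := by
  rw [realify_dotProduct]

/-- Unit complex vectors realify to unit real vectors. -/
theorem realify_dotProduct_self_eq_one {z : n → ℂ} (hz : ∑ i, ‖z i‖ ^ 2 = 1) :
    realify z ⬝ᵥ realify z = 1 := by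
  rw [realify_dotProduct_self, hz]

end Summit.Ventures.LatticeQCDFlow.Exactness
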